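import Literature.Probability.LatticeModels.IntersectionSecondMoment
import HarnessLib

/-!
# The second-moment step for two independent double-current clusters with DISJOINT source pairs
# (Aizenman–Duminil-Copin 2021, Lemma 4.4, two-base form)

Topic `Literature/Probability/LatticeModels`. THEOREM-ONLY leaf file (no definitions, no named facts).
`IntersectionSecondMoment.lean` proves the three displays of the second-moment argument of
Aizenman–Duminil-Copin 2021, Lemma 4.4, for two independent double currents whose source pairs
`{o,x}`, `{o,z}` SHARE the base point `o` (both clusters are read at `o`). The random-current route to
non-Gaussianity on `ℤ³` (the four-current "fat step" `P^{ab,∅} ⊗ P^{ce,∅}[C_{n₁+n₃}(a) ∩ C_{n₂+n₄}(c) ∩ A ≠ ∅]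
≥ M₁²/M₂` with disjoint source pairs `{a,b}`, `{c,e}`; ADC21 eq. (3.13) and §4.2) needs the same three
displays with the two clusters read at DIFFERENT base points `a` and `c`. They are the same proof
(the one-point identity `tsum_epairWeight_mul_indicator_mem_cluster` and Proposition A.3
`ecurrentSum_empty_mul_tsum_double_conn_le` applied once per pair, Fubini, and the `ℝ≥0∞`
Cauchy–Schwarz inequality `tsum_mul_sq_le_tsum_indicator_mul_tsum_sq`), recorded here in
un-normalised current-sum form for edge couplings `K ≥ 0` on a finite simple graph; with the
intersection count `N(p,q) = ∑_{v ∈ A} 𝟙[v ∈ C_{p₁+p₂}(a)] 𝟙[v ∈ C_{q₁+q₂}(c)]` and the product weight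
`W(p,q) = 1{∂p₁={a}∆{b}}1{∂p₂=∅} w w · 1{∂q₁={c}∆{e}}1{∂q₂=∅} w w` written inline:

* `Current.tsum_pairs_mul_interCount_twoBase` — first moment `∑ W N = ∑_{v ∈ A} (Z[bv]Z[av])(Z[ev]Z[cv])`;
* `Current.sq_mul_tsum_pairs_mul_interCount_twoBase_sq_le` — second moment
  `Z[∅]² ∑ W N² ≤ ∑_{v,w ∈ A} B_{ab}(v,w) B_{ce}(v,w)` with the two-step bound `twoStepBound` of the tree;
* `Current.tsum_pairs_mul_interCount_twoBase_sq_le` — `(∑ W N)² ≤ (∑ W 𝟙[N ≠ 0]) (∑ W N²)`, and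
  `Current.sum_connInd_mul_connInd_ne_zero_iff` — `N ≠ 0 ↔` the two clusters meet inside `A`.

All sources are symmetric differences `{a} ∆ {b}`, so every coincidence (`a = b`: sourceless pair;
`v ∈ {a,b}`; `v = w`) is covered, as in the tree. At `a = c` these are literally the tree's statements.

## References

* M. Aizenman, H. Duminil-Copin, *Marginal triviality of the scaling limits of critical 4D Ising and
  `λφ⁴₄` models*, Ann. of Math. 194 (2021), arXiv:1912.07973, §3.2 eq. (3.13), §4.2 proof of Lemma 4.4,
  Appendix A Prop. A.3 [AizenmanDuminilCopinAnnals2021].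
-/

noncomputable section

open Finset Filter
open scoped symmDiff ENNReal

namespace Literature.Probability.LatticeModels

variable {V : Type*} [Fintype V] [DecidableEq V] {G : SimpleGraph V} [DecidableRel G.Adj]

namespace Current

variable {K : G.edgeFinset → ℝ}

/-- `N(p,q) = ∑_{v ∈ A} 𝟙[v ∈ C_p(a)] 𝟙[v ∈ C_q(c)] ≠ 0` iff the cluster of `a` in `p` and the
cluster of `c` in `q` meet inside `A`. [folklore] -/
theorem sum_connInd_mul_connInd_ne_zero_iff (A : Finset V) (a c : V) (p q : Current G × Current G) :
    (∑ v ∈ A, connInd v a p * connInd v c q) ≠ 0 ↔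
      ∃ v ∈ A, v ∈ (p.1 + p.2).cluster a ∧ v ∈ (q.1 + q.2).cluster c := by
  unfold connInd
  rw [Ne, Finset.sum_eq_zero_iff, not_forall]
  constructor
  · rintro ⟨v, hv⟩
    rw [Classical.not_imp] at hv
    obtain ⟨hvA, hne⟩ := hv
    refine ⟨v, hvA, ?_, ?_⟩
    · by_contra h; exact hne (by rw [if_neg h, zero_mul])
    · by_contra h; exact hne (by rw [if_neg h, mul_zero])
  · rintro ⟨v, hvA, hp, hq⟩
    refine ⟨v, fun h => ?_⟩
    have := h hvA
    rw [if_pos hp, if_pos hq, mul_one] at this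
    exact one_ne_zero this

/-- Fubini for the product weight of the two independent pairs against a product function. [folklore] -/
theorem tsum_pairs_mul_mul (K : G.edgeFinset → ℝ) (a b c e : V)
    (f g : Current G × Current G → ℝ≥0∞) :
    ∑' pq : (Current G × Current G) × (Current G × Current G),
        (epairWeight K ({a} ∆ {b}) ∅ pq.1 * epairWeight K ({c} ∆ {e}) ∅ pq.2) * (f pq.1 * g pq.2) =
      (∑' p, epairWeight K ({a} ∆ {b}) ∅ p * f p) * ∑' q, epairWeight K ({c} ∆ {e}) ∅ q * g q := by
  rw [tsum_mul_tsum_eq_tsum_prod]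
  exact tsum_congr fun pq => by ring

/-- **First moment, two-base form** (ADC21, proof of Lemma 4.4, first display, with source pairs
`{a,b}` and `{c,e}` and the clusters read at `a` resp. `c`):
`∑ W N = ∑_{v ∈ A} (Z[bv] Z[av]) · (Z[ev] Z[cv])` — the one-point identity
`∑ 1{ab}1{∅} w w 𝟙[v ∈ C(a)] = Z[bv]Z[av]` once per pair. [cite: AizenmanDuminilCopinAnnals2021, arXiv:1912.07973 §4.2, proof of Lemma 4.4 (first moment of |𝓜|)] -/
theorem tsum_pairs_mul_interCount_twoBase (hK : ∀ e, 0 ≤ K e) (A : Finset V) (a b c e : V) :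
    ∑' pq : (Current G × Current G) × (Current G × Current G),
        (epairWeight K ({a} ∆ {b}) ∅ pq.1 * epairWeight K ({c} ∆ {e}) ∅ pq.2) *
          (∑ v ∈ A, connInd v a pq.1 * connInd v c pq.2) =
      ∑ v ∈ A, (ecurrentSum K ({b} ∆ {v}) * ecurrentSum K ({a} ∆ {v})) *
        (ecurrentSum K ({e} ∆ {v}) * ecurrentSum K ({c} ∆ {v})) := by
  simp_rw [Finset.mul_sum]
  rw [Summable.tsum_finsetSum (fun _ _ => ENNReal.summable)]
  refine Finset.sum_congr rfl fun v _ => ?_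
  rw [tsum_pairs_mul_mul K a b c e (connInd v a) (connInd v c)]
  unfold connInd
  rw [tsum_epairWeight_mul_indicator_mem_cluster hK a b v, tsum_epairWeight_mul_indicator_mem_cluster hK c e v]

/-- **Second moment, two-base form** (ADC21, proof of Lemma 4.4, second and third displays):
`Z[∅]² ∑ W N² ≤ ∑_{v,w ∈ A} B_{ab}(v,w) B_{ce}(v,w)`, with the tree's two-step bound
`twoStepBound K a b v w = Z[av]Z[vw]Z[wb] + Z[aw]Z[wv]Z[vb]` (Proposition A.3 once per pair).
[cite: AizenmanDuminilCopinAnnals2021, arXiv:1912.07973 §4.2, proof of Lemma 4.4 (second moment of |𝓜|) and Appendix A.2, Proposition A.3] -/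
theorem sq_mul_tsum_pairs_mul_interCount_twoBase_sq_le (hK : ∀ e, 0 ≤ K e) (A : Finset V) (a b c e : V) :
    ecurrentSum K ∅ ^ 2 *
        ∑' pq : (Current G × Current G) × (Current G × Current G),
          (epairWeight K ({a} ∆ {b}) ∅ pq.1 * epairWeight K ({c} ∆ {e}) ∅ pq.2) *
            (∑ v ∈ A, connInd v a pq.1 * connInd v c pq.2) ^ 2 ≤
      ∑ v ∈ A, ∑ w ∈ A, twoStepBound K a b v w * twoStepBound K c e v w := by
  -- expand the square and exchange sums
  have hexp : ∀ pq : (Current G × Current G) × (Current G × Current G),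
      (epairWeight K ({a} ∆ {b}) ∅ pq.1 * epairWeight K ({c} ∆ {e}) ∅ pq.2) *
          (∑ v ∈ A, connInd v a pq.1 * connInd v c pq.2) ^ 2 =
        ∑ v ∈ A, ∑ w ∈ A, (epairWeight K ({a} ∆ {b}) ∅ pq.1 * epairWeight K ({c} ∆ {e}) ∅ pq.2) *
          ((connInd v a pq.1 * connInd w a pq.1) * (connInd v c pq.2 * connInd w c pq.2)) := by
    intro pq
    rw [sq, Finset.sum_mul_sum, Finset.mul_sum]
    refine Finset.sum_congr rfl fun v _ => ?_
    rw [Finset.mul_sum]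
    exact Finset.sum_congr rfl fun w _ => by ring
  rw [tsum_congr hexp, Summable.tsum_finsetSum (fun _ _ => ENNReal.summable), Finset.mul_sum]
  refine Finset.sum_le_sum fun v _ => ?_
  rw [Summable.tsum_finsetSum (fun _ _ => ENNReal.summable), Finset.mul_sum]
  refine Finset.sum_le_sum fun w _ => ?_
  rw [tsum_pairs_mul_mul K a b c e (fun p => connInd v a p * connInd w a p)
    (fun q => connInd v c q * connInd w c q)]
  calc ecurrentSum K ∅ ^ 2 * ((∑' p, epairWeight K ({a} ∆ {b}) ∅ p * (connInd v a p * connInd w a p)) *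
          ∑' q, epairWeight K ({c} ∆ {e}) ∅ q * (connInd v c q * connInd w c q))
      = (ecurrentSum K ∅ * ∑' p, epairWeight K ({a} ∆ {b}) ∅ p * (connInd v a p * connInd w a p)) *
          (ecurrentSum K ∅ * ∑' q, epairWeight K ({c} ∆ {e}) ∅ q * (connInd v c q * connInd w c q)) := by
        ring
    _ ≤ twoStepBound K a b v w * twoStepBound K c e v w :=
        mul_le_mul' (ecurrentSum_empty_mul_tsum_connInd_mul_connInd_le hK a b v w)
          (ecurrentSum_empty_mul_tsum_connInd_mul_connInd_le hK c e v w)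

/-- **Second-moment (Cauchy–Schwarz) lower bound for the two-base intersection event**
(ADC21, proof of Lemma 4.4: "`P[𝓜 ≠ ∅] ≥ E[|𝓜|]²/E[|𝓜|²]`"), un-normalised and cross-multiplied:
`(∑ W N)² ≤ (∑ W 𝟙[N ≠ 0]) · (∑ W N²)`, where `𝟙[N ≠ 0]` is the indicator that `C_{p}(a)` and
`C_{q}(c)` meet inside `A` (`sum_connInd_mul_connInd_ne_zero_iff`). [cite: AizenmanDuminilCopinAnnals2021, arXiv:1912.07973 §4.2, proof of Lemma 4.4 (second-moment inequality)] -/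
theorem tsum_pairs_mul_interCount_twoBase_sq_le (K : G.edgeFinset → ℝ) (A : Finset V) (a b c e : V) :
    (∑' pq : (Current G × Current G) × (Current G × Current G),
        (epairWeight K ({a} ∆ {b}) ∅ pq.1 * epairWeight K ({c} ∆ {e}) ∅ pq.2) *
          (∑ v ∈ A, connInd v a pq.1 * connInd v c pq.2)) ^ 2 ≤
      (∑' pq : (Current G × Current G) × (Current G × Current G),
        (epairWeight K ({a} ∆ {b}) ∅ pq.1 * epairWeight K ({c} ∆ {e}) ∅ pq.2) *
          (if (∑ v ∈ A, connInd v a pq.1 * connInd v c pq.2) = 0 then 0 else 1)) *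
        ∑' pq : (Current G × Current G) × (Current G × Current G),
          (epairWeight K ({a} ∆ {b}) ∅ pq.1 * epairWeight K ({c} ∆ {e}) ∅ pq.2) *
            (∑ v ∈ A, connInd v a pq.1 * connInd v c pq.2) ^ 2 := by
  -- name the weight and the count to keep unification first-order
  set W : (Current G × Current G) × (Current G × Current G) → ℝ≥0∞ :=
    fun pq => epairWeight K ({a} ∆ {b}) ∅ pq.1 * epairWeight K ({c} ∆ {e}) ∅ pq.2 with hW
  set N : (Current G × Current G) × (Current G × Current G) → ℝ≥0∞ :=
    fun pq => ∑ v ∈ A, connInd v a pq.1 * connInd v c pq.2 with hN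
  exact tsum_mul_sq_le_tsum_indicator_mul_tsum_sq W N

/-- Sanity check: at `a = c` the two-base count is the tree's `interCount`, and the two-base product
weight is the tree's `prodWeight` (definitionally). [folklore] -/
theorem interCount_eq_sum_connInd (A : Finset V) (o : V) (p q : Current G × Current G) :
    interCount A o p q = ∑ v ∈ A, connInd v o p * connInd v o q := rfl

end Current

end Literature.Probability.LatticeModels

end
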